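import Summits.BirchSwinnertonDyer.BirchSwinnertonDyer.Theorems.GenusKolyvaginAtTwoGenusPrimitiveSupplyAtTwoPosDiscShallowSwapTypeReadsDepthBit
import Literature.NumberTheory.GaloisRepresentations.FrobeniusDensity
import Literature.NumberTheory.Automorphic.ChebotarevArtinRepHolds
import Literature.NumberTheory.EllipticCurves.GaloisActionProofs
import HarnessLib

/-!
# Route `GenusKolyvaginAtTwo`, crux 25504 (K4Pos = stmt-BirchSwinnertonDyer-31469), positive depth: FROM GALOIS ELEMENTS TO PRIMES —
# the positive-depth bit of a Galois element is the bit of an ARITHMETIC FROBENIUS at a prime outside any finite set (Čebotarev)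

Seat `bsd-line-gk2-p5` g35 (cell `bsd-f1-sign2`, WIDTH-5 attach), `--supports stmt-BirchSwinnertonDyer-31469 --as helper`.  THEOREMS ONLY; UNCONDITIONAL
(Čebotarev for Artin representations is the tree THEOREM `Literature.NumberTheory.Automorphic.chebotarev_artinRep_holds`).  **BSD is NOT proved by this
file, no item is closed.**

WHY.  p766882/p768152 produce, on the habitat K₄⁺/K₄ frame, Galois elements `γ₀ ∈ Γ_ℚ` of transposition type with NON-ZERO and with ZERO positive-depth
bit (`SwapRead.exists_kummer_bit_ne_zero_of_habitat` / `…_eq_zero_of_habitat`).  The bit `bit(γ; w′, t) = γ•t₁ + t₁`, `t₁ = γw′ + w′ − s`, depends on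
`γ` only through `γ•w′`, `γ•(γ₀•w′)` and `γ•t` — finitely many point conditions, an OPEN coset of `Γ_ℚ` — so the Frobenius elements, dense in `Γ_ℚ`
(`absoluteGaloisGroup.frobenius_dense`), meet it:

* §1 `exists_isArithFrobAt_forall_smul_eq` — for ANY `γ₀ ∈ Γ_ℚ`, any finite set of geometric points `pts` and any finite set `S` of places of `ℚ`,
  some arithmetic Frobenius `γ` at a prime `𝔓 ∣ v`, `v ∉ S`, has `γ•P = γ₀•P` for all `P ∈ pts` (stabilisers are open,
  `WeierstrassCurve.isOpen_stabilizer_point_holds`; Čebotarev).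
* §2 `bit_eq_of_smul_eq` — `bit(γ) = bit(γ₀)` as soon as `γ` and `γ₀` agree on `w′`, `γ₀•w′`, `t`.
* §3 **`exists_isArithFrobAt_bit_eq`** — hence for ANY `γ₀`, `w′`, `t`, `u` and finite `S`: an arithmetic Frobenius `γ` at a prime over some `v ∉ S`
  with **`bit(γ) = bit(γ₀)`** and `γ•u = γ₀•u` (so `γ` moves `u` iff `γ₀` does — the K₄⁺ clause `∃ u : E[2], h•u ≠ u` is inherited).  Feeding
  p768152 §5/§6: on every habitat K₄⁺ frame there are primes (outside any finite set) whose Frobenius is of transposition type with NON-ZERO bit,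
  and primes whose Frobenius is of transposition type with ZERO bit — instrument I3⁺ is genuinely two-valued on primes.  (The bit is read as
  «`red_λ(y_K/2^{M₀}) ∈ 2Ẽ(𝔽_{ℓ²})`» by p766882 §3 at the place prime.)

References: [TateGCFT1967] §2.4; [SerreAbelianLadic1968] Ch. I §2.2; [GrossLMS1991] §3 (3.1)–(3.3), §6 Prop. 6.2; [SilvermanAEC2009] App. B.2.
-/

set_option autoImplicit false
set_option linter.dupNamespace false -- `Summit.<P>.<Sub>` repeats `BirchSwinnertonDyer` (D-0017)

noncomputable section

open scoped Classical NumberField Pointwise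

namespace Summit.BirchSwinnertonDyer.BirchSwinnertonDyer.Theorems.GenusSupplyNarrow.SwapRead

open IsDedekindDomain Field WeierstrassCurve Literature.NumberTheory.EllipticCurves Literature.NumberTheory.GaloisRepresentations

variable (W : WeierstrassCurve ℚ)

/-! ## §1 Čebotarev: a Frobenius agreeing with a given element on finitely many points -/

/-- **An arithmetic Frobenius, outside any finite set of places, agreeing with a given `γ₀ ∈ Γ_ℚ` on finitely many geometric points.**  The coset
`γ₀ · ⋂_{P ∈ pts} Stab(P)` is open (`isOpen_stabilizer_point_holds`) and non-empty; the Frobenius elements at primes over `v ∉ S` are dense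
(`absoluteGaloisGroup.frobenius_dense`, Čebotarev `chebotarev_artinRep_holds`). [cite: TateGCFT1967, §2.4] [cite: SerreAbelianLadic1968, Ch. I §2.2, Cor. 2] -/
theorem exists_isArithFrobAt_forall_smul_eq (γ₀ : absoluteGaloisGroup ℚ) (pts : Finset W.geomPoints)
    (S : Set (HeightOneSpectrum (𝓞 ℚ))) (hS : S.Finite) :
    ∃ (γ : absoluteGaloisGroup ℚ) (v : HeightOneSpectrum (𝓞 ℚ)) (𝔓 : Ideal (absIntegers (𝓞 ℚ) ℚ)),
      v ∉ S ∧ 𝔓 ∈ v.primesAbove ∧ IsArithFrobAt (𝓞 ℚ) γ 𝔓 ∧ ∀ P ∈ pts, γ • P = γ₀ • P := by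
  -- the open subgroup fixing the points of `pts`
  set H : Set (absoluteGaloisGroup ℚ) := ⋂ P ∈ pts, (MulAction.stabilizer (absoluteGaloisGroup ℚ) P : Set (absoluteGaloisGroup ℚ)) with hH
  have hHopen : IsOpen H := by
    refine isOpen_biInter_finset fun P _ ↦ ?_
    exact W.isOpen_stabilizer_point_holds P
  -- its left coset by `γ₀`
  set O : Set (absoluteGaloisGroup ℚ) := (fun γ ↦ γ₀ * γ) '' H with hO
  have hOopen : IsOpen O := (Homeomorph.mulLeft γ₀).isOpenMap _ hHopen
  have h1H : (1 : absoluteGaloisGroup ℚ) ∈ H := by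
    simp only [hH, Set.mem_iInter, SetLike.mem_coe, MulAction.mem_stabilizer_iff, one_smul, implies_true]
  have hOne : O.Nonempty := ⟨γ₀ * 1, 1, h1H, rfl⟩
  obtain ⟨γ, hγO, v, hvS, 𝔓, h𝔓, hγ⟩ :=
    (absoluteGaloisGroup.frobenius_dense Literature.NumberTheory.Automorphic.chebotarev_artinRep_holds ℚ S hS).inter_open_nonempty O hOopen hOne
  obtain ⟨h, hh, rfl⟩ := hγO
  refine ⟨γ₀ * h, v, 𝔓, hvS, h𝔓, hγ, fun P hP ↦ ?_⟩
  have hhP : h • P = P := by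
    have := Set.mem_iInter₂.mp hh P hP
    exact this
  rw [mul_smul, hhP]

/-! ## §2 The bit depends only on `γ•w′`, `γ•(γ₀•w′)`, `γ•t` -/

/-- **`bit(γ) = bit(γ₀)`** when `γ•w′ = γ₀•w′`, `γ•(γ₀•w′) = γ₀•(γ₀•w′)` and `γ•t = γ₀•t` (`bit(γ) = γ•t₁ + t₁`, `t₁ = γw′ + w′ − s`, `s` a multiple of `t`).
[cite: GrossLMS1991, §6 Prop. 6.2] -/
theorem bit_eq_of_smul_eq {γ γ₀ : absoluteGaloisGroup ℚ} {w' t : W.geomPoints} (hw : γ • w' = γ₀ • w') (hww : γ • (γ₀ • w') = γ₀ • (γ₀ • w'))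
    (ht : γ • t = γ₀ • t) :
    γ • (γ • w' + w' - (((addOrderOf t + 1) / 2 : ℕ) : ℤ) • t) + (γ • w' + w' - (((addOrderOf t + 1) / 2 : ℕ) : ℤ) • t) =
      γ₀ • (γ₀ • w' + w' - (((addOrderOf t + 1) / 2 : ℕ) : ℤ) • t) + (γ₀ • w' + w' - (((addOrderOf t + 1) / 2 : ℕ) : ℤ) • t) := by
  rw [smul_sub, smul_add, smul_sub, smul_add, smul_zsmul_geomPoints', smul_zsmul_geomPoints', hw, hww, ht]

/-! ## §3 Primes realising the bit of a given element -/

/-- **PRIMES REALISING THE POSITIVE-DEPTH BIT OF A GIVEN GALOIS ELEMENT.**  For ANY `γ₀ ∈ Γ_ℚ`, points `w′, t, u ∈ E(ℚ̄)` and finite set `S` of places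
of `ℚ`: there are a place `v ∉ S`, a prime `𝔓 ∣ v` of `\bar ℤ` and an arithmetic Frobenius `γ` at `𝔓` with **`bit(γ; w′, t) = bit(γ₀; w′, t)`** and
`γ•u = γ₀•u`, `γ•w′ = γ₀•w′`, `γ•t = γ₀•t` (so `γ` inherits `γ₀`'s frame clauses `γ•w = −w + t`, `γ•t = t` and moves `u` iff `γ₀` does).  With p768152
§5/§6 (transposition-type elements of BOTH bit values on every habitat K₄⁺ frame) this makes instrument I3⁺ two-valued ON PRIMES, outside any finite
set.  UNCONDITIONAL.  [cite: TateGCFT1967, §2.4] [cite: GrossLMS1991, §3 (3.1)–(3.3), §6 Prop. 6.2] -/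
theorem exists_isArithFrobAt_bit_eq (γ₀ : absoluteGaloisGroup ℚ) (w' t u : W.geomPoints)
    (S : Set (HeightOneSpectrum (𝓞 ℚ))) (hS : S.Finite) :
    ∃ (γ : absoluteGaloisGroup ℚ) (v : HeightOneSpectrum (𝓞 ℚ)) (𝔓 : Ideal (absIntegers (𝓞 ℚ) ℚ)),
      v ∉ S ∧ 𝔓 ∈ v.primesAbove ∧ IsArithFrobAt (𝓞 ℚ) γ 𝔓 ∧ γ • w' = γ₀ • w' ∧ γ • t = γ₀ • t ∧ γ • u = γ₀ • u ∧
      γ • (γ • w' + w' - (((addOrderOf t + 1) / 2 : ℕ) : ℤ) • t) + (γ • w' + w' - (((addOrderOf t + 1) / 2 : ℕ) : ℤ) • t) =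
        γ₀ • (γ₀ • w' + w' - (((addOrderOf t + 1) / 2 : ℕ) : ℤ) • t) + (γ₀ • w' + w' - (((addOrderOf t + 1) / 2 : ℕ) : ℤ) • t) := by
  obtain ⟨γ, v, 𝔓, hvS, h𝔓, hγ, hagree⟩ := exists_isArithFrobAt_forall_smul_eq W γ₀ ({w', γ₀ • w', t, u} : Finset W.geomPoints) S hS
  have hw : γ • w' = γ₀ • w' := hagree w' (by simp)
  have hww : γ • (γ₀ • w') = γ₀ • (γ₀ • w') := hagree (γ₀ • w') (by simp)
  have ht : γ • t = γ₀ • t := hagree t (by simp)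
  have hu : γ • u = γ₀ • u := hagree u (by simp)
  exact ⟨γ, v, 𝔓, hvS, h𝔓, hγ, hw, ht, hu, bit_eq_of_smul_eq W hw hww ht⟩

/-- **The frame clauses are inherited**: if `γ•w′ = γ₀•w′`, `γ•t = γ₀•t`, `2w′ = w`, `γ₀•w = −w + t`, `γ₀•t = t`, then `γ•w = −w + t` and `γ•t = t`;
and `γ•u ≠ u ↔ γ₀•u ≠ u` when `γ•u = γ₀•u`.  Bookkeeping for feeding §3 into p766882/p768152. [folklore] -/
theorem frame_of_smul_eq {γ γ₀ : absoluteGaloisGroup ℚ} {w w' t u : W.geomPoints} (hw' : (2 : ℤ) • w' = w) (hγ₀w : γ₀ • w = -w + t)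
    (hγ₀t : γ₀ • t = t) (hw : γ • w' = γ₀ • w') (ht : γ • t = γ₀ • t) (hu : γ • u = γ₀ • u) :
    γ • w = -w + t ∧ γ • t = t ∧ (γ • u ≠ u ↔ γ₀ • u ≠ u) := by
  refine ⟨?_, by rw [ht, hγ₀t], by rw [hu]⟩
  rw [← hw', smul_zsmul_geomPoints', hw, ← smul_zsmul_geomPoints', hw', hγ₀w]

end Summit.BirchSwinnertonDyer.BirchSwinnertonDyer.Theorems.GenusSupplyNarrow.SwapRead

end
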